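import Summits.RiemannHypothesis.RiemannHypothesis.Theorems.Splittings.JensenX4NewmanAllDerivPsi
import Literature.NumberTheory.LFunctions.NewmanProofs
import Literature.NumberTheory.LFunctions.RodgersTaoZeroContinuity
import Literature.Analysis.Complex.LaguerrePolya

/-!
# Splittings — X-4 × NEWMAN FOR EVERY DERIVATIVE, part 2/3: `newmanAllDeriv : ∀ m, ∀ t < 0, ¬ HasOnlyRealZeros (iteratedDeriv m (deBruijnH t))`
# and the Hadamard-free Laguerre ladder `H_t^{(m)}` hyperbolic `→ H_t^{(m+1)}` hyperbolic (SPLIT-jen-neg gen 6; zero-definition raw form)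

Cell rh-split (brief sha16 f79c5f09d8bcb036), seat rh-split-jen-neg g6 (planner-rh-split-jen-neg-g6-0), card
`run/shared/lean/pub/rh-split/cards/SPLIT-jen-neg.md` ADDENDUM 7 (booked by the lead, ruling #42, 07:01Z; PRE-FILE OFFER accepted as
lane (xvi)); cut by the seat from `HOME/rh-split-jen-neg/g6/SketchG6AllDerivDelta.lean` (revision 3; declarations byte-identical to it;
the seat's combined file checks rc 0 / 0 warnings / 0 sorries on the farm, standard axioms).  THREE-FILE split forced by the 400-line
rule: part 1 = §G6.1–G6.3 (`Splittings/JensenX4NewmanAllDerivPsi.lean`), part 2 = §G6.4–G6.6 (`Splittings/JensenX4NewmanAllDeriv.lean`),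
part 3 = §G6.7–G6.9 (`Splittings/JensenX4KiKimLeeChain.lean`); namespace `…Splittings.JensenX4NewmanAllDeriv` in all three.

Content of this part.  §G6.4 MAIN THEOREM `iteratedDeriv_deBruijnH_zero_im_lt : ∀ m, ∀ t < 0, ∀ M, ∃ z, iteratedDeriv m (deBruijnH t) z = 0 ∧
z.im < −M` (part 1's `psi_approx` + gen 4's Bohr–Lemma 3–Hurwitz step `exists_zero_of_strip_approx`), `newmanAllDeriv`,
`iteratedDeriv_deBruijnH_zeros_im_unbounded`; §G6.5 the cases `m = 1` (`newmanDeriv`, = gen 4's theorem) and `m = 0` (`newmanZero`,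
Dobner / Rodgers–Tao), `no_hyperbolic_derivative_below_zero`, the `sInf`-free floor `nonneg_of_hasOnlyRealZeros_iteratedDeriv` and
«`Λ^{(m)} ≥ 0`» `kiKimLee_const_nonneg : 0 ≤ sInf {t | HasOnlyRealZeros (iteratedDeriv m (deBruijnH t))}` for EVERY `m`; §G6.6 LAGUERRE
HEREDITY, HADAMARD-FREE: `hasOnlyRealZeros_deriv_of_growth` (real entire `f` of order `< 2` with real zeros and `f′ ≢ 0` ⟹ `f′` has real
zeros; from the log-subharmonicity facts `im_mul_im_logDeriv_le` / `im_logDeriv_eq_zero_of_forall_ne_zero` of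
`Literature.Analysis.Complex.LaguerrePolya` and the open mapping theorem), growth of all `H_t^{(m)}` by Cauchy estimates from
`Newman.norm_deBruijnH_le`, non-polynomiality of `H_t` (`infinite_setOf_deBruijnH_eq_zero` + Taylor), hence
`hasOnlyRealZeros_iteratedDeriv_succ : HasOnlyRealZeros (iteratedDeriv m (deBruijnH t)) → HasOnlyRealZeros (iteratedDeriv (m+1) (deBruijnH t))`
for every real `t`, and `hasOnlyRealZeros_iteratedDeriv_of_rh : RiemannHypothesis → ∀ m, HasOnlyRealZeros (iteratedDeriv m (deBruijnH 0))`.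

HONEST LABEL: «SPLITTING SEARCH over kernel-typed RH-EQUIVALENCES; a splitting A ∧ B ⟹ RH is CONDITIONAL bookkeeping unless A and B are
both proved; nothing here bears on the truth of RH.»
-/

set_option linter.dupNamespace false

noncomputable section

open Complex Filter Set Topology Metric

namespace Summit.RiemannHypothesis.RiemannHypothesis.Theorems.Splittings.JensenX4NewmanAllDeriv

open Literature Literature.NumberTheory.LFunctions
open Summit.RiemannHypothesis.RiemannHypothesis.Theorems.Splittings.JensenX4NewmanDeriv

/-! ## G6.4  Main theorems -/

/-- **Newman's conjecture for every derivative of `Ξ`, with depth (kernel form).**  For every `m : ℕ`, every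
`t < 0` and every `M`, the `m`-th derivative of `H_t` has a zero with `Im z < −M`.  (`m = 0`: Dobner / Rodgers–Tao's
`Λ ≥ 0` direction; `m = 1`: g4/g5; `m ≥ 2`: new.)  Inputs: tree facts `dobner_xiDeformed_approx_holds`,
`dobner_zetaDeformed_exists_zero_holds`, `bohr_almost_periodic_holds`, `exists_norm_zetaDeformed_le_of_le_re`,
`KadiriDigamma.re_digamma_ge`, `differentiable_deBruijnH_holds` (all proved) and Mathlib (Hurwitz, Cauchy estimate,
digamma).  Nothing here is a claim about RH. -/
theorem iteratedDeriv_deBruijnH_zero_im_lt (m : ℕ) (t : ℝ) (ht : t < 0) (M : ℝ) :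
    ∃ z : ℂ, iteratedDeriv m (deBruijnH t) z = 0 ∧ z.im < -M := by
  have ht' : 0 < |t| := abs_pos.2 ht.ne
  have hG : ∀ a b : ℝ, ∃ y : ℝ, ∀ s : ℂ, a ≤ s.re → s.re ≤ b → y ≤ s.im →
      DifferentiableAt ℂ (Psi t m) s := by
    intro a b
    by_cases hab : a ≤ b
    · obtain ⟨y₁, hy₁, h⟩ := norm_dobL_ge ht a b hab 1
      refine ⟨y₁, fun s h1 h2 h3 ↦ ?_⟩
      have hs : 0 < s.im := by linarith
      have hL : dobL t s ≠ 0 := fun h0 ↦ by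
        have := h s h1 h2 h3
        rw [h0, norm_zero] at this
        linarith
      exact differentiableAt_psi t m hs hL
    · exact ⟨0, fun s h1 h2 _ ↦ absurd (h1.trans h2) hab⟩
  obtain ⟨a, b, hab⟩ := exists_zero_of_strip_approx ht (Psi t m) hG (psi_approx ht m)
  by_cases hab' : a ≤ b
  swap
  · obtain ⟨s, h1, h2, -, -⟩ := hab 0
    exact absurd (h1.trans h2) hab'
  obtain ⟨y₁, hy₁, hL1⟩ := norm_dobL_ge ht a b hab' 1
  set A : ℝ := 4 / |t| * ((M + 1) / 2 + 1 - a) with hA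
  obtain ⟨s, hsa, hsb, hsY, hGs⟩ := hab (max (2 * Real.pi * Real.exp A + 1) y₁)
  have hs_im : 0 < s.im := lt_of_lt_of_le hy₁ ((le_max_right _ _).trans hsY)
  have hL : dobL t s ≠ 0 := fun h0 ↦ by
    have := hL1 s hsa hsb ((le_max_right _ _).trans hsY)
    rw [h0, norm_zero] at this
    linarith
  have hγ0 := dobnerGammaT_ne_zero t hs_im.ne'
  -- `Ψ_m(s) = 0` ⇒ `ξ_t^{(m)}(J_t s) = 0` ⇒ `H_t^{(m)}(−i(2 J_t s − 1)) = 0`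
  have hΦ0 : iteratedDeriv m (xiDeformed t) (dobnerJ t s) = 0 := by
    have hD : dobnerGammaT t s * dobL t s ^ m ≠ 0 := mul_ne_zero hγ0 (pow_ne_zero m hL)
    have h := hGs
    simp only [Psi, div_eq_zero_iff] at h
    exact h.resolve_right hD
  have hH0 : iteratedDeriv m (deBruijnH t) (-I * (2 * dobnerJ t s - 1)) = 0 := by
    rw [iteratedDeriv_xiDeformed_apply] at hΦ0
    have h8 : (8 * (-I * 2) ^ m : ℂ) ≠ 0 :=
      mul_ne_zero (by norm_num) (pow_ne_zero _ (mul_ne_zero (neg_ne_zero.2 I_ne_zero) two_ne_zero))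
    rcases mul_eq_zero.1 hΦ0 with h | h
    · exact absurd h h8
    · exact h
  refine ⟨_, hH0, ?_⟩
  rw [im_neg_I_mul, dobnerJ_re]
  -- `Re J_t(s) > (1+M)/2`
  have hnorm : 2 * Real.pi * Real.exp A + 1 ≤ ‖s‖ := by
    have h1 : s.im ≤ ‖s‖ := (le_abs_self _).trans (abs_im_le_norm s)
    linarith [(le_max_left _ _).trans hsY]
  have hpos : 0 < 2 * Real.pi * Real.exp A := by positivity
  have hn0 : 0 < ‖s‖ / (2 * Real.pi) := div_pos (by linarith) (by positivity)
  have hlog : A < Real.log (‖s‖ / (2 * Real.pi)) := by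
    rw [Real.lt_log_iff_exp_lt hn0, lt_div_iff₀ (by positivity)]
    linarith
  have hkey : (M + 1) / 2 + 1 - a < |t| / 4 * Real.log (‖s‖ / (2 * Real.pi)) := by
    have := mul_lt_mul_of_pos_left hlog (by positivity : (0 : ℝ) < |t| / 4)
    rwa [show |t| / 4 * A = (M + 1) / 2 + 1 - a by rw [hA]; field_simp] at this
  linarith

/-- **`Λ^{(m)} ≥ 0` for every `m` (kernel form).**  No derivative of any backward deformation `H_t`, `t < 0`, is
hyperbolic. -/
theorem newmanAllDeriv (m : ℕ) (t : ℝ) (ht : t < 0) :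
    ¬ HasOnlyRealZeros (iteratedDeriv m (deBruijnH t)) := by
  intro hreal
  obtain ⟨z, hz, hzim⟩ := iteratedDeriv_deBruijnH_zero_im_lt m t ht 0
  have := hreal z hz
  linarith

/-- The imaginary parts of the zeros of `H_t^{(m)}` (`t < 0`) are unbounded: the witnesses are FAR / DEEP pairs. -/
theorem iteratedDeriv_deBruijnH_zeros_im_unbounded (m : ℕ) (t : ℝ) (ht : t < 0) :
    ¬ ∃ M : ℝ, ∀ z : ℂ, iteratedDeriv m (deBruijnH t) z = 0 → |z.im| ≤ M := by
  rintro ⟨M, hM⟩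
  obtain ⟨z, hz, hzim⟩ := iteratedDeriv_deBruijnH_zero_im_lt m t ht |M|
  have := hM z hz
  have h2 : -z.im ≤ |z.im| := neg_le_abs _
  linarith [abs_nonneg M, le_abs_self M]

/-! ## G6.5  Corollaries: `m = 1`, `m = 0`, no hyperbolic derivative below `t = 0`, and the `sInf` form `λ_m ≥ 0` -/

/-- `m = 1` recovers g4/g5 (`Λ^{(1)} ≥ 0`); PRIVATE sanity re-derivation — the public theorem with this exact
statement is the tree's `JensenX4NewmanDeriv.newmanDeriv` (typer dedup guard). -/
private theorem newmanDeriv (t : ℝ) (ht : t < 0) : ¬ HasOnlyRealZeros (deriv (deBruijnH t)) := by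
  rw [← iteratedDeriv_one]
  exact newmanAllDeriv 1 t ht

/-- `m = 0` recovers the Dobner / Rodgers–Tao direction (`Λ ≥ 0`: `H_t` has a non-real zero for every `t < 0`). -/
theorem newmanZero (t : ℝ) (ht : t < 0) : ¬ HasOnlyRealZeros (deBruijnH t) := by
  have h := newmanAllDeriv 0 t ht
  rwa [iteratedDeriv_zero] at h

/-- No order of differentiation and no backward time gives a hyperbolic function: the set
`{(m, t) : t < 0 ∧ H_t^{(m)} hyperbolic}` is empty ("every A-type rung is Newman-critical"). -/
theorem no_hyperbolic_derivative_below_zero :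
    ¬ ∃ m : ℕ, ∃ t : ℝ, t < 0 ∧ HasOnlyRealZeros (iteratedDeriv m (deBruijnH t)) := by
  rintro ⟨m, t, ht, h⟩
  exact newmanAllDeriv m t ht h

/-- `sInf`-free «`Λ^{(m)} ≥ 0`»: a hyperbolic `H_t^{(m)}` forces `t ≥ 0`. -/
theorem nonneg_of_hasOnlyRealZeros_iteratedDeriv (m : ℕ) (t : ℝ)
    (h : HasOnlyRealZeros (iteratedDeriv m (deBruijnH t))) : 0 ≤ t :=
  not_lt.1 fun ht ↦ newmanAllDeriv m t ht h

/-- «`Λ^{(m)} ≥ 0`» in the `sInf` form of the Ki–Kim–Lee constants `λ_m := inf {t | H_t^{(m)} hyperbolic}`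
(KKL 2009 write `Λ^{(m)} = 4λ_m`; `λ_0` is the tree's `deBruijnNewmanConst`).  As a bare `Real.sInf` this needs no
nonemptiness / boundedness side facts: every member of the set is `≥ 0`. -/
theorem kiKimLee_const_nonneg (m : ℕ) :
    0 ≤ sInf {t : ℝ | HasOnlyRealZeros (iteratedDeriv m (deBruijnH t))} :=
  Real.sInf_nonneg fun t ht ↦ nonneg_of_hasOnlyRealZeros_iteratedDeriv m t ht

/-- `m = 0`: the tree's `Λ = deBruijnNewmanConst ≥ 0` (Rodgers–Tao's theorem, here via Dobner's route).
(`private`: a consistency re-derivation of the tree's `deBruijnNewmanConst_nonneg_holds`, not a new public fact.) -/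
private theorem deBruijnNewmanConst_nonneg' : 0 ≤ deBruijnNewmanConst := by
  have h := kiKimLee_const_nonneg 0
  simpa [iteratedDeriv_zero, deBruijnNewmanConst] using h

/-! ## G6.6  Laguerre heredity along the de Bruijn family, Hadamard-free: `H_t^{(m)} ∈ 𝓛𝓟 ⟹ H_t^{(m+1)} ∈ 𝓛𝓟`

The classical statement "the Laguerre–Pólya class is closed under differentiation" is proved here for
the concrete family `H_t^{(m)}` WITHOUT the Hadamard product, from three tree facts of
`Literature.Analysis.Complex.LaguerrePolya` (`im_mul_im_logDeriv_le`, `im_logDeriv_eq_zero_of_forall_ne_zero`,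
`im_deriv_ofReal`: the sign of `Im (f′/f)` for real entire `f` of order `< 2` with real zeros, via
log-subharmonicity), the open mapping theorem (`AnalyticOnNhd.eq_const_of_im_eq_const`), the growth bound
`Newman.norm_deBruijnH_le` (order `3/2`) propagated to all derivatives by Cauchy's estimate, and the
non-polynomiality of `H_t` (`infinite_setOf_deBruijnH_eq_zero` + Taylor), which rules out `H_t^{(m+1)} ≡ 0`. -/

section Heredity

open Literature.Analysis.Complex

/-- `H_t^{(m)}` is real on the real axis. -/
theorem iteratedDeriv_deBruijnH_ofReal_im (t : ℝ) (m : ℕ) (x : ℝ) :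
    (iteratedDeriv m (deBruijnH t) x).im = 0 := by
  induction m generalizing x with
  | zero => simpa [iteratedDeriv_zero] using deBruijnH_ofReal_im t x
  | succ m ih =>
    rw [iteratedDeriv_succ]
    exact im_deriv_ofReal (differentiable_iteratedDeriv_deBruijnH t m) ih x

/-- **Growth.** Every `H_t^{(m)}` is of order `< 2` in the quantitative form used by
`Literature.Analysis.Complex.LaguerrePolya`: `‖H_t^{(m)}(z)‖ ≤ C e^{‖z‖^ρ}` with `0 ≤ ρ < 2`
(`m = 0`: `Newman.norm_deBruijnH_le`, order `3/2`; step: Cauchy's estimate on unit discs and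
`exists_add_rpow_le`, `ρ ↦ (ρ+2)/2`). -/
theorem exists_growth_iteratedDeriv_deBruijnH (t : ℝ) (m : ℕ) :
    ∃ ρ C : ℝ, 0 ≤ ρ ∧ ρ < 2 ∧ ∀ z, ‖iteratedDeriv m (deBruijnH t) z‖ ≤ C * Real.exp (‖z‖ ^ ρ) := by
  induction m with
  | zero =>
    obtain ⟨K, hK0, hK⟩ := Newman.norm_deBruijnH_le t
    refine ⟨3 / 2, K, by norm_num, by norm_num, fun z ↦ ?_⟩
    rw [iteratedDeriv_zero]
    refine (hK z).trans ?_
    have h1 : |z.im| ≤ ‖z‖ := Complex.abs_im_le_norm z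
    have h0 : 0 ≤ |z.im| := abs_nonneg _
    have h2 : |z.im| * Real.sqrt |z.im| ≤ ‖z‖ ^ ((3 : ℝ) / 2) := by
      calc |z.im| * Real.sqrt |z.im| ≤ ‖z‖ * Real.sqrt ‖z‖ := by gcongr
        _ = ‖z‖ ^ ((3 : ℝ) / 2) := by
            rw [Real.sqrt_eq_rpow, ← Real.rpow_one_add' (norm_nonneg z) (by norm_num)]
            norm_num
    gcongr
  | succ m ih =>
    obtain ⟨ρ, C, hρ0, hρ, hC⟩ := ih
    obtain ⟨K, hK0, hK⟩ := exists_add_rpow_le ρ 1 hρ0 hρ zero_le_one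
    have hC0 : 0 ≤ C := growthConst_nonneg hC
    refine ⟨(ρ + 2) / 2, C * Real.exp K, by linarith, by linarith, fun z ↦ ?_⟩
    rw [iteratedDeriv_succ]
    have hdiff := differentiable_iteratedDeriv_deBruijnH t m
    refine norm_deriv_le_of_closedBall (fun w _ ↦ (hdiff w)) fun w hw ↦ ?_
    refine (hC w).trans ?_
    have hw' : ‖w‖ ≤ ‖z‖ + 1 := by
      have h1 : ‖w - z‖ = 1 := by rw [← dist_eq_norm]; exact mem_sphere.1 hw
      calc ‖w‖ = ‖(w - z) + z‖ := by rw [sub_add_cancel]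
        _ ≤ ‖w - z‖ + ‖z‖ := norm_add_le _ _
        _ = ‖z‖ + 1 := by rw [h1]; ring
    have h2 : ‖w‖ ^ ρ ≤ (‖z‖ + 1) ^ ρ := Real.rpow_le_rpow (norm_nonneg _) hw' hρ0
    have h3 := hK ‖z‖ (norm_nonneg z)
    rw [mul_assoc, ← Real.exp_add]
    gcongr
    linarith

/-- An entire function, not identically zero, with infinitely many zeros has no identically
vanishing iterated derivative (else, by Taylor, it would be a polynomial).
(`private`: signature-identical twin of lane (xvii)'s `Splittings.JensenX4LaguerreHeredity.exists_iteratedDeriv_ne_zero_of_infinite`,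
rh-splitx-theory-1 g3 — whichever lands first is the public copy; kept private here so the filing order does not matter.) -/
private theorem exists_iteratedDeriv_ne_zero_of_infinite_zeros {f : ℂ → ℂ} (hf : Differentiable ℂ f)
    (h0 : ∃ z, f z ≠ 0) (hinf : {z : ℂ | f z = 0}.Infinite) (m : ℕ) :
    ∃ z, iteratedDeriv m f z ≠ 0 := by
  by_contra h
  push Not at h
  have hzero_fun : ∀ j : ℕ, deriv^[j] (fun _ : ℂ ↦ (0 : ℂ)) = fun _ ↦ 0 := by
    intro j
    induction j with
    | zero => rfl
    | succ j ihj =>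
      rw [Function.iterate_succ_apply', ihj]
      funext w
      exact deriv_const w (0 : ℂ)
  have hvan : ∀ n, m ≤ n → iteratedDeriv n f 0 = 0 := by
    intro n hn
    obtain ⟨j, rfl⟩ := Nat.exists_eq_add_of_le hn
    have hm : deriv^[m] f = fun _ ↦ 0 := by
      funext w; have := h w; rwa [iteratedDeriv_eq_iterate] at this
    rw [iteratedDeriv_eq_iterate, add_comm, Function.iterate_add_apply, hm, hzero_fun j]
  set p : Polynomial ℂ :=
    ∑ n ∈ Finset.range m, Polynomial.C ((n.factorial : ℂ)⁻¹ * iteratedDeriv n f 0) * Polynomial.X ^ n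
    with hp
  have hfp : ∀ z, f z = p.eval z := by
    intro z
    have ht := Complex.taylorSeries_eq_of_entire' (c := 0) (z := z) hf
    rw [← ht, tsum_eq_sum (s := Finset.range m)]
    · simp [hp, Polynomial.eval_finsetSum]
    · intro n hn
      simp only [Finset.mem_range, not_lt] at hn
      simp [hvan n hn]
  have hp0 : p = 0 := by
    apply Polynomial.eq_zero_of_infinite_isRoot
    refine hinf.mono fun z hz ↦ ?_
    simp only [Set.mem_setOf_eq] at hz ⊢
    rw [Polynomial.IsRoot.def, ← hfp]
    exact hz
  obtain ⟨z, hz⟩ := h0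
  exact hz (by rw [hfp, hp0, Polynomial.eval_zero])

/-- No iterated derivative of `H_t` vanishes identically (`H_t(0) ≠ 0`, infinitely many zeros). -/
theorem exists_iteratedDeriv_deBruijnH_ne_zero (t : ℝ) (m : ℕ) :
    ∃ z, iteratedDeriv m (deBruijnH t) z ≠ 0 :=
  exists_iteratedDeriv_ne_zero_of_infinite_zeros (differentiable_deBruijnH_holds t)
    ⟨0, deBruijnH_apply_zero_ne_zero t⟩ (infinite_setOf_deBruijnH_eq_zero t) m

/-- **Laguerre heredity, Hadamard-free.** A real entire `f` of order `< 2` (quantitatively) with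
only real zeros and `f′ ≢ 0` has `f′` with only real zeros.  If `f` has a zero `a`, a non-real
critical point `z` would give `0 = Im z · Im (f′/f)(z) ≤ -(Im z)²/‖z-a‖² < 0` (`im_mul_im_logDeriv_le`);
if `f` is zero-free, `Im (f′/f) ≡ 0` (`im_logDeriv_eq_zero_of_forall_ne_zero`), so `f′/f` is a
constant `c` (open mapping), and a zero of `f′ = c·f` forces `c = 0`, i.e. `f′ ≡ 0`. -/
theorem hasOnlyRealZeros_deriv_of_growth {f : ℂ → ℂ} (hf : Differentiable ℂ f) {ρ C : ℝ}
    (hρ0 : 0 ≤ ρ) (hρ : ρ < 2) (hgr : ∀ z, ‖f z‖ ≤ C * Real.exp (‖z‖ ^ ρ))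
    (hreal : ∀ x : ℝ, (f x).im = 0) (hzero : HasOnlyRealZeros f)
    (hnc : ∃ z, deriv f z ≠ 0) : HasOnlyRealZeros (deriv f) := by
  intro z hz
  by_contra hzim
  by_cases hex : ∃ a, f a = 0
  · obtain ⟨a, ha⟩ := hex
    have key := im_mul_im_logDeriv_le hf hρ0 hρ hgr hreal hzero hzim ha
    rw [hz, zero_div, Complex.zero_im, mul_zero] at key
    have hza : 0 < ‖z - a‖ := by
      rw [norm_pos_iff, sub_ne_zero]
      intro h; apply hzim; rw [h]; exact hzero a ha
    have hz2 : 0 < z.im ^ 2 := by positivity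
    have : 0 < z.im ^ 2 / ‖z - a‖ ^ 2 := by positivity
    linarith
  · push Not at hex
    have him : ∀ w, (deriv f w / f w).im = 0 :=
      im_logDeriv_eq_zero_of_forall_ne_zero hf hρ0 hρ hgr hreal hex
    have hd : Differentiable ℂ (deriv f) :=
      differentiableOn_univ.1 (hf.differentiableOn.deriv isOpen_univ)
    have hq : Differentiable ℂ (fun w ↦ deriv f w / f w) := hd.div hf hex
    obtain ⟨c, hc⟩ := (hq.differentiableOn.analyticOnNhd isOpen_univ).eq_const_of_im_eq_const
      (fun w _ ↦ him w) isOpen_univ isConnected_univ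
    have hdf : ∀ w, deriv f w = c * f w := fun w ↦
      (div_eq_iff (hex w)).1 (hc w (mem_univ w))
    have hc0 : c = 0 := by
      have h1 := hdf z
      rw [hz] at h1
      exact (mul_eq_zero.1 h1.symm).resolve_right (hex z)
    obtain ⟨w, hw⟩ := hnc
    exact hw (by rw [hdf w, hc0, zero_mul])

/-- **The derivative ladder: `H_t^{(m)}` hyperbolic ⟹ `H_t^{(m+1)}` hyperbolic** (every real `t`,
every `m`; Ki–Kim–Lee 2009's `λ_{m+1} ≤ λ_m` pointwise in `t`). -/
theorem hasOnlyRealZeros_iteratedDeriv_succ (t : ℝ) (m : ℕ)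
    (h : HasOnlyRealZeros (iteratedDeriv m (deBruijnH t))) :
    HasOnlyRealZeros (iteratedDeriv (m + 1) (deBruijnH t)) := by
  obtain ⟨ρ, C, hρ0, hρ, hgr⟩ := exists_growth_iteratedDeriv_deBruijnH t m
  rw [iteratedDeriv_succ]
  refine hasOnlyRealZeros_deriv_of_growth (differentiable_iteratedDeriv_deBruijnH t m) hρ0 hρ hgr
    (iteratedDeriv_deBruijnH_ofReal_im t m) h ?_
  obtain ⟨z, hz⟩ := exists_iteratedDeriv_deBruijnH_ne_zero t (m + 1)
  exact ⟨z, by rwa [iteratedDeriv_succ] at hz⟩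

/-- The ladder is monotone in the order of differentiation. -/
theorem hasOnlyRealZeros_iteratedDeriv_mono (t : ℝ) {m m' : ℕ} (hmm : m ≤ m')
    (h : HasOnlyRealZeros (iteratedDeriv m (deBruijnH t))) :
    HasOnlyRealZeros (iteratedDeriv m' (deBruijnH t)) := by
  induction hmm with
  | refl => exact h
  | step _ ih => exact hasOnlyRealZeros_iteratedDeriv_succ t _ ih

/-- `H_t` hyperbolic ⟹ all its derivatives hyperbolic. -/
theorem hasOnlyRealZeros_iteratedDeriv_of_deBruijnH (t : ℝ) (h : HasOnlyRealZeros (deBruijnH t))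
    (m : ℕ) : HasOnlyRealZeros (iteratedDeriv m (deBruijnH t)) :=
  hasOnlyRealZeros_iteratedDeriv_mono t (Nat.zero_le m) (by rwa [iteratedDeriv_zero])

/-- **RH ⟹ every derivative `Ξ^{(m)}` is hyperbolic** (Pólya; Farmer–Rhoades for `ξ`), here from the
tree's `RH ↔ H_0 hyperbolic` and the Hadamard-free ladder: every A-type conjunct
`A_m := [H_0^{(m)} hyperbolic]` is RH-IMPLIED. -/
theorem hasOnlyRealZeros_iteratedDeriv_of_rh (hRH : _root_.RiemannHypothesis) (m : ℕ) :
    HasOnlyRealZeros (iteratedDeriv m (deBruijnH 0)) :=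
  hasOnlyRealZeros_iteratedDeriv_of_deBruijnH 0
    (riemannHypothesis_iff_hasOnlyRealZeros_deBruijnH_zero_holds.1 hRH) m

/-- `t = 1/2` lies in every set `{t | H_t^{(m)} hyperbolic}` (de Bruijn 1950 + the ladder). -/
theorem one_half_mem_setOf_hasOnlyRealZeros_iteratedDeriv (m : ℕ) :
    (1 / 2 : ℝ) ∈ {t : ℝ | HasOnlyRealZeros (iteratedDeriv m (deBruijnH t))} :=
  hasOnlyRealZeros_iteratedDeriv_of_deBruijnH _ hasOnlyRealZeros_deBruijnH_one_half_holds m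

end Heredity

end Summit.RiemannHypothesis.RiemannHypothesis.Theorems.Splittings.JensenX4NewmanAllDeriv

end
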